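import Summits.AtomisticToContinuum.HydrodynamicLimit.Theorems.MourreKoopmanChargesLinearToEntropyInBandVisCoreNToolkitC
import Summits.AtomisticToContinuum.HydrodynamicLimit.Theorems.AntiMazurCoboundariesShearStressHalfDrudeFrozenGlueHelpers
import Mathlib.MeasureTheory.Integral.IntervalIntegral.Periodic
import HarnessLib

/-!
# Route `MourreKoopmanCharges`, crux `LinearToEntropyInBand` (stmt-AtomisticToContinuum-17740), skeleton v8:
# stub 4a-ii, the covering lemma — the block density of the VISIBLE particles is geometrically bounded (plan § 3)

Support file (`--supports stmt-AtomisticToContinuum-17740`; registered helper `stub_windowClauseCovering`; worker of lead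
prover-line-…-17740-c5-0, wave 5; plan `work/stubs/WINDOWCLAUSE-PLAN.md` § 1 (3) D3, § 3 "covering lemma").

`visCoreN` (DefsB (e)) smooths the VISIBLE particles — slow, and `R`-cone dilute: `(N+1)⁻¹ Σⱼ cone R N xᵢ xⱼ ≤ (3/2) ρs(xᵢ)`
— at the block scale `k (N+1)^{-1/3}` into `visDensityN`; the flux piece evaluates the equation of state at
`min(ρ̄, 2ρs(x)) σ³`.  The plan (D3) asked for a deterministic covering inequality making the cap inactive,
`ρ̄_vis ≤ (3/2) ρs (1 + C R/k)`.  THAT SHARP FORM IS FALSE: a face-centred cubic array of micro-clusters at mutual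
minimal-image distance `Rν` (`ν = (N+1)^{-1/3}`; the cone kernel of radius `Rν` vanishes there), each cluster of `R`-cone
density exactly `(3/2) ρs`, consists of visible particles only and has `k`-block density `→ (π√2/3)·(3/2) ρs ≈ 2.22 ρs > 2ρs`
as `k/R → ∞` (cluster mass `(π/2) ρs (Rν)³ (N+1)`, site density `√2 (Rν)⁻³`; the spheres, of diameter `σν ≪ Rν`, fit).
What IS true, and what the chain needs (a `K, k, N`-free bound on the visible block fields, hence on the capped flux
functional `visFluxDensityN`; the cap is inactive only NEAR the Euler state, `ρ̄ ≈ ρ_s < 2ρ_s`, which is where the quadratic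
one-block remainder is expanded), is the CRUDE form with an explicit geometric constant:

* § 4 `visDensityN_le_geometric`: `visDensityN ρs us R K k N z x ≤ 3 (8 + R/k)³ ρmax` for `0 < R`, `0 < k`, `Rν ≤ 4`,
  `ρs ≤ ρmax`, `0 ≤ ρmax` — for `k ≥ R` at most `2187 ρmax`.  Deterministic, every configuration, every `x`.

Proof (§§ 1–3): in the SUP metric of `𝕋³ = (ℝ/ℤ)³` (a genuine `MetricSpace`, Haar volume of a closed `a`-ball `= (2a)³` for
`2a ≤ 1`; `dist ≤ euclidDist ≤ 2 dist` against the minimal-image Euclidean distance of `cone`, § 1 and the landed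
`ShearStressHalfDrudeFrozenGlueHelpers.dist_le_euclidDist`), a maximal
`Rν/4`-separated subset `T` of the visible particles within `kν` of `x` covers them by its `Rν/4`-neighbourhoods
(`exists_separated_cover`), has `|T| ≤ ((kν + Rν/8)/(Rν/8))³` elements by volume packing (`card_le_of_separated`, § 2), and
each neighbourhood, its centre being VISIBLE and the cone kernel at least half its peak `3/(π(Rν)³)` within Euclidean
distance `Rν/2` (§ 3), holds at most `(N+1) π (Rν)³ ρs(centre)` particles (`card_near_visible_le`); each contributor weighs at
most the peak `3/(π(kν)³)`.  Nothing here restates the crux, a stub, a neighbour's stub or the Statement.  References: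
S. Olla, S. R. S. Varadhan, H.-T. Yau, Commun. Math. Phys. 155 (1993) § 4 (block averages and cut-offs); P. Mattila,
*Geometry of Sets and Measures in Euclidean Spaces* (1995), Ch. 2 (packing by volume comparison).
-/

noncomputable section

open MeasureTheory Filter Set Metric
open scoped ENNReal Topology InnerProductSpace BigOperators

namespace Summit.AtomisticToContinuum.HydrodynamicLimit.Theorems.LTEInBand

open Literature.MathematicalPhysics.KineticTheory Literature.Analysis.FluidPDE Literature.Analysis.FunctionSpaces
open Summit.AtomisticToContinuum.HydrodynamicLimit.Theorems.ShearStressHalfDrudeFrozenGlueHelpers (dist_le_euclidDist)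

/-! ## § 1 The sup metric of `𝕋³` versus the minimal-image Euclidean distance -/

section Metric

/-- The sup (product) distance of `𝕋³ = (ℝ/ℤ)³` is dominated by the minimal-image Euclidean distance
(`ShearStressHalfDrudeFrozenGlueHelpers.dist_le_euclidDist`, landed); conversely `euclidDist p q ≤ 2 dist p q`
(`‖·‖₂ ≤ √3 ‖·‖_∞ ≤ 2 ‖·‖_∞` on `ℝ³`, coordinatewise `|reprSym (p − q) i| = dist (p i) (q i) ≤ dist p q`). -/
theorem euclidDist_le_two_mul_dist (p q : T3) : Torus.euclidDist p q ≤ 2 * dist p q := by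
  have hc : ∀ i, |Torus.reprSym (p - q) i| ≤ dist p q := fun i => by
    rw [Torus.abs_reprSym_apply, Pi.sub_apply, ← dist_eq_norm]
    exact dist_le_pi_dist p q i
  have hd : 0 ≤ dist p q := dist_nonneg
  have hsq : Torus.euclidDist p q ^ 2 ≤ (2 * dist p q) ^ 2 := by
    rw [Torus.euclidDist_eq, EuclideanSpace.norm_sq_eq, Fin.sum_univ_three]
    simp only [Real.norm_eq_abs, sq_abs]
    have h0 := hc 0; have h1 := hc 1; have h2 := hc 2
    rw [abs_le] at h0 h1 h2
    nlinarith
  exact (pow_le_pow_iff_left₀ (norm_nonneg _) (by positivity) two_ne_zero).1 hsq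

/-- The Haar volume of a closed sup-ball of `𝕋³` of radius `a`, `0 ≤ a`, `2a ≤ 1`, is `(2a)³`. -/
theorem volume_closedBall_T3 (p : T3) {a : ℝ} (ha : 0 ≤ a) (ha1 : 2 * a ≤ 1) :
    volume (closedBall p a) = ENNReal.ofReal (2 * a) ^ 3 := by
  rw [volume_pi_closedBall p ha]
  simp only [AddCircle.volume_closedBall, min_eq_right ha1, Finset.prod_const, Finset.card_univ, Fintype.card_fin]

/-- The Haar volume of a closed sup-ball of `𝕋³` of radius `a ≥ 0` is at most `(2a)³`. -/
theorem volume_closedBall_T3_le (p : T3) {a : ℝ} (ha : 0 ≤ a) : volume (closedBall p a) ≤ ENNReal.ofReal (2 * a) ^ 3 := by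
  rw [volume_pi_closedBall p ha]
  calc ∏ i, volume (closedBall (p i) a) ≤ ∏ _i : Fin 3, ENNReal.ofReal (2 * a) := by
        refine Finset.prod_le_prod' fun i _ => ?_
        rw [AddCircle.volume_closedBall]
        exact ENNReal.ofReal_le_ofReal (min_le_right _ _)
    _ = ENNReal.ofReal (2 * a) ^ 3 := by rw [Finset.prod_const, Finset.card_univ, Fintype.card_fin]

end Metric

/-! ## § 2 Packing and covering in the sup metric -/

section Packing

variable {N : ℕ}

/-- **Packing bound.** A set of particle indices whose positions are pairwise more than `2a` apart in the sup metric
(`0 < a`, `2a ≤ 1`) and all within sup-distance `L` of a point `x` has at most `((L + a)/a)³` elements (the closed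
`a`-balls are disjoint, of volume `(2a)³` each, inside the `(L + a)`-ball of volume `≤ (2(L + a))³`). -/
theorem card_le_of_separated (z : Config (N + 1) (Fin 3) T3) (x : T3) {a L : ℝ} (ha : 0 < a) (ha1 : 2 * a ≤ 1)
    (hL0 : 0 ≤ L) (T : Finset (Fin (N + 1))) (hL : ∀ p ∈ T, dist x (z p).1 ≤ L)
    (hsep : ∀ p ∈ T, ∀ q ∈ T, p ≠ q → 2 * a < dist (z p).1 (z q).1) :
    (T.card : ℝ) ≤ ((L + a) / a) ^ 3 := by
  have hLa : 0 ≤ L + a := by linarith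
  -- disjoint balls inside the big ball
  have hdisj : (T : Set (Fin (N + 1))).PairwiseDisjoint fun p => closedBall (z p).1 a := by
    intro p hp q hq hpq
    exact closedBall_disjoint_closedBall (by linarith [hsep p hp q hq hpq])
  have hsub : (⋃ p ∈ T, closedBall (z p).1 a) ⊆ closedBall x (L + a) := by
    refine Set.iUnion₂_subset fun p hp => closedBall_subset_closedBall' ?_
    rw [dist_comm]; linarith [hL p hp]
  have hmeas : volume (⋃ p ∈ T, closedBall (z p).1 a) = ∑ p ∈ T, volume (closedBall (z p).1 a) :=
    measure_biUnion_finset hdisj fun p _ => measurableSet_closedBall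
  have hvol : (T.card : ℝ≥0∞) * ENNReal.ofReal (2 * a) ^ 3 ≤ ENNReal.ofReal (2 * (L + a)) ^ 3 := by
    calc (T.card : ℝ≥0∞) * ENNReal.ofReal (2 * a) ^ 3 = ∑ p ∈ T, volume (closedBall (z p).1 a) := by
          rw [Finset.sum_congr rfl fun p _ => volume_closedBall_T3 (z p).1 ha.le ha1, Finset.sum_const, nsmul_eq_mul]
      _ = volume (⋃ p ∈ T, closedBall (z p).1 a) := hmeas.symm
      _ ≤ volume (closedBall x (L + a)) := measure_mono hsub
      _ ≤ ENNReal.ofReal (2 * (L + a)) ^ 3 := volume_closedBall_T3_le x hLa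
  -- back to the reals
  have hreal : (T.card : ℝ) * (2 * a) ^ 3 ≤ (2 * (L + a)) ^ 3 := by
    have h1 : ENNReal.ofReal ((T.card : ℝ) * (2 * a) ^ 3) = (T.card : ℝ≥0∞) * ENNReal.ofReal (2 * a) ^ 3 := by
      rw [ENNReal.ofReal_mul (p := (T.card : ℝ)) (Nat.cast_nonneg _), ENNReal.ofReal_natCast,
        ENNReal.ofReal_pow (by positivity)]
    have h2 : ENNReal.ofReal ((2 * (L + a)) ^ 3) = ENNReal.ofReal (2 * (L + a)) ^ 3 := ENNReal.ofReal_pow (by positivity) 3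
    rw [← h1, ← h2] at hvol
    exact (ENNReal.ofReal_le_ofReal_iff (by positivity)).1 hvol
  rw [div_pow, le_div_iff₀ (by positivity)]
  nlinarith [hreal]

open Classical in
/-- **Covering by a maximal separated subset.** For any set `W` of particle indices and `0 < a` there is a subset
`T ⊆ W` pairwise more than `2a` apart (sup metric) such that every particle of `W` is within `2a` of a particle of `T`
(a `2a`-separated subset of maximal cardinality). -/
theorem exists_separated_cover (z : Config (N + 1) (Fin 3) T3) {a : ℝ} (ha : 0 < a) (W : Finset (Fin (N + 1))) :
    ∃ T : Finset (Fin (N + 1)), T ⊆ W ∧ (∀ p ∈ T, ∀ q ∈ T, p ≠ q → 2 * a < dist (z p).1 (z q).1) ∧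
      ∀ i ∈ W, ∃ p ∈ T, dist (z i).1 (z p).1 ≤ 2 * a := by
  set fam : Finset (Finset (Fin (N + 1))) :=
    W.powerset.filter fun T => ∀ p ∈ T, ∀ q ∈ T, p ≠ q → 2 * a < dist (z p).1 (z q).1 with hfam
  have hne : fam.Nonempty := ⟨∅, by simp [hfam]⟩
  obtain ⟨T, hT, hmax⟩ := fam.exists_max_image Finset.card hne
  simp only [hfam, Finset.mem_filter, Finset.mem_powerset] at hT
  refine ⟨T, hT.1, hT.2, fun i hi => ?_⟩
  by_contra hcov
  push Not at hcov
  have hiT : i ∉ T := fun h => by linarith [hcov i h, dist_self (z i).1]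
  have hins : insert i T ∈ fam := by
    simp only [hfam, Finset.mem_filter, Finset.mem_powerset]
    refine ⟨Finset.insert_subset hi hT.1, fun p hp q hq hpq => ?_⟩
    rcases Finset.mem_insert.1 hp with rfl | hp'
    · rcases Finset.mem_insert.1 hq with rfl | hq'
      · exact absurd rfl hpq
      · exact hcov q hq'
    · rcases Finset.mem_insert.1 hq with rfl | hq'
      · rw [dist_comm]; exact hcov p hp'
      · exact hT.2 p hp' q hq' hpq
  have := hmax _ hins
  rw [Finset.card_insert_of_notMem hiT] at this
  omega

end Packing

/-! ## § 3 The cone kernel: peak, support, and the half-peak core -/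

section Cone

variable {N : ℕ}

/-- The cone kernel is at most its peak `3/(π (aν)³)` (`ν = (N+1)^{-1/3}`, `0 < a`). -/
theorem cone_le_peak' {a : ℝ} (ha : 0 < a * ((N : ℝ) + 1) ^ (-(1 / 3 : ℝ))) (x y : T3) :
    cone a N x y ≤ 3 / (Real.pi * (a * ((N : ℝ) + 1) ^ (-(1 / 3 : ℝ))) ^ 3) := by
  unfold cone
  have hpk : 0 ≤ 3 / (Real.pi * (a * ((N : ℝ) + 1) ^ (-(1 / 3 : ℝ))) ^ 3) := by positivity
  refine (mul_le_of_le_one_right hpk (max_le zero_le_one ?_))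
  have : 0 ≤ Torus.euclidDist x y / (a * ((N : ℝ) + 1) ^ (-(1 / 3 : ℝ))) := div_nonneg (norm_nonneg _) ha.le
  linarith

/-- The cone kernel vanishes outside the radius `aν`. -/
theorem cone_eq_zero_of_le {a : ℝ} (ha : 0 < a * ((N : ℝ) + 1) ^ (-(1 / 3 : ℝ))) {x y : T3}
    (h : a * ((N : ℝ) + 1) ^ (-(1 / 3 : ℝ)) ≤ Torus.euclidDist x y) : cone a N x y = 0 := by
  unfold cone
  rw [max_eq_left, mul_zero]
  rw [sub_nonpos, le_div_iff₀ ha, one_mul]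
  exact h

/-- Within half the radius the cone kernel is at least half its peak. -/
theorem half_peak_le_cone {a : ℝ} (ha : 0 < a * ((N : ℝ) + 1) ^ (-(1 / 3 : ℝ))) {x y : T3}
    (h : Torus.euclidDist x y ≤ a * ((N : ℝ) + 1) ^ (-(1 / 3 : ℝ)) / 2) :
    3 / (Real.pi * (a * ((N : ℝ) + 1) ^ (-(1 / 3 : ℝ))) ^ 3) / 2 ≤ cone a N x y := by
  unfold cone
  have hpk : 0 ≤ 3 / (Real.pi * (a * ((N : ℝ) + 1) ^ (-(1 / 3 : ℝ))) ^ 3) := by positivity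
  rw [div_eq_mul_inv _ (2 : ℝ)]
  refine mul_le_mul_of_nonneg_left (le_max_of_le_right ?_) hpk
  rw [le_sub_comm, div_le_iff₀ ha]
  linarith

end Cone

/-! ## § 4 The covering lemma -/

section Covering

variable {N : ℕ}

open Classical in
/-- **A visible particle certifies a bounded number of particles in its `Rν/4` sup-neighbourhood**: if `p` is visible
(`R`-cone density `≤ (3/2) ρs(x_p)`), then `#{j : dist(x_p, x_j) ≤ Rν/4} ≤ (N+1) π (Rν)³ ρs(x_p)` (every such `j` is
within Euclidean distance `Rν/2` of `x_p`, where the cone kernel is at least half its peak `3/(π (Rν)³)`). -/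
theorem card_near_visible_le {ρs : T3 → ℝ} {us : T3 → V3} {R K : ℝ} (hR : 0 < R * ((N : ℝ) + 1) ^ (-(1 / 3 : ℝ)))
    {z : Config (N + 1) (Fin 3) T3} {p : Fin (N + 1)} (hp : VisibleN ρs us R K N z p) :
    ((Finset.univ.filter fun j => dist (z p).1 (z j).1 ≤ R * ((N : ℝ) + 1) ^ (-(1 / 3 : ℝ)) / 4).card : ℝ) ≤
      ((N : ℝ) + 1) * (Real.pi * (R * ((N : ℝ) + 1) ^ (-(1 / 3 : ℝ))) ^ 3) * ρs (z p).1 := by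
  set r : ℝ := R * ((N : ℝ) + 1) ^ (-(1 / 3 : ℝ)) with hr
  set B := Finset.univ.filter fun j => dist (z p).1 (z j).1 ≤ r / 4 with hB
  have hN : (0 : ℝ) < (N : ℝ) + 1 := by positivity
  have hpk : 0 < 3 / (Real.pi * r ^ 3) := by positivity
  -- the visibility bound on the full cone sum
  have hvis : ∑ j, cone R N (z p).1 (z j).1 ≤ ((N : ℝ) + 1) * (3 / 2 * ρs (z p).1) := by
    have h := hp.2
    rwa [inv_mul_le_iff₀ hN] at h
  -- the near particles contribute at least half the peak each
  have hcore : (B.card : ℝ) * (3 / (Real.pi * r ^ 3) / 2) ≤ ∑ j, cone R N (z p).1 (z j).1 := by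
    calc (B.card : ℝ) * (3 / (Real.pi * r ^ 3) / 2) = ∑ j ∈ B, 3 / (Real.pi * r ^ 3) / 2 := by
          rw [Finset.sum_const, nsmul_eq_mul]
      _ ≤ ∑ j ∈ B, cone R N (z p).1 (z j).1 := by
          refine Finset.sum_le_sum fun j hj => half_peak_le_cone hR ?_
          have hj' : dist (z p).1 (z j).1 ≤ r / 4 := (Finset.mem_filter.1 hj).2
          linarith [euclidDist_le_two_mul_dist (z p).1 (z j).1]
      _ ≤ ∑ j, cone R N (z p).1 (z j).1 :=
          Finset.sum_le_sum_of_subset_of_nonneg (Finset.subset_univ _) fun j _ _ =>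
            cone_nonneg N (le_of_lt (pos_of_mul_pos_left hR (by positivity))) _ _
  have h := hcore.trans hvis
  have hr3 : 0 < Real.pi * r ^ 3 := by positivity
  have hid : (B.card : ℝ) * (3 / (Real.pi * r ^ 3) / 2) = (3 / (Real.pi * r ^ 3) / 2) * (B.card : ℝ) := mul_comm _ _
  have hid' : ((N : ℝ) + 1) * (3 / 2 * ρs (z p).1) =
      (3 / (Real.pi * r ^ 3) / 2) * (((N : ℝ) + 1) * (Real.pi * r ^ 3) * ρs (z p).1) := by
    field_simp
  rw [hid, hid'] at h
  exact le_of_mul_le_mul_left h (by positivity)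

open Classical in
/-- **The covering lemma: the block density of the VISIBLE particles is bounded by the reference density, up to a
geometric constant.** For radii `0 < R`, `0 < k` (`Rν ≤ 4`, `ν = (N+1)^{-1/3}`: the `Rν/8` sup-balls are honest) and a
bound `ρs ≤ ρmax`, `0 ≤ ρmax`, every configuration `z` and every `x ∈ 𝕋³` satisfy
`visDensityN ρs us R K k N z x ≤ 3 (8 + R/k)³ ρmax` — for `k ≥ R` at most `3·9³ ρmax = 2187 ρmax`.
Proof: the visible particles within `kν` of `x` (the only contributors, each with weight `≤ 3/(π (kν)³)`) are covered by
the `Rν/4` sup-neighbourhoods of a maximal `Rν/4`-separated visible subset `T` (`exists_separated_cover`); each such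
neighbourhood holds `≤ (N+1) π (Rν)³ ρmax` particles (`card_near_visible_le`: its centre is VISIBLE), and
`|T| ≤ ((kν + Rν/8)/(Rν/8))³` by packing (`card_le_of_separated`).  The SHARP form `ρ̄_vis ≤ (3/2) ρs (1 + C R/k)` of
the plan is FALSE: a periodic array of micro-clusters at mutual distance `Rν`, each of `R`-cone density exactly
`(3/2) ρs`, consists of visible particles only and has `k`-block density `→ (π√2/3)(3/2) ρs ≈ 2.2 ρs > 2 ρs` as
`k/R → ∞` (face-centred cubic array), so the EOS cap `min(ρ̄, 2ρs)` of `visCoreN` is NOT inactive deterministically;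
what the chain gets from this lemma is a `K, k, N`-free bound on the visible block fields (hence on the capped flux
functional), the cap being inactive only near the Euler state `ρ̄ ≈ ρs < 2ρs`. -/
theorem visDensityN_le_geometric {ρs : T3 → ℝ} {us : T3 → V3} {R K k ρmax : ℝ} (hR : 0 < R) (hk : 0 < k)
    (hRν : R * ((N : ℝ) + 1) ^ (-(1 / 3 : ℝ)) ≤ 4) (hρmax : 0 ≤ ρmax) (hρs : ∀ y, ρs y ≤ ρmax)
    (z : Config (N + 1) (Fin 3) T3) (x : T3) :
    visDensityN ρs us R K k N z x ≤ 3 * (8 + R / k) ^ 3 * ρmax := by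
  set ν : ℝ := ((N : ℝ) + 1) ^ (-(1 / 3 : ℝ)) with hν
  have hN : (0 : ℝ) < (N : ℝ) + 1 := by positivity
  have hν0 : 0 < ν := Real.rpow_pos_of_pos hN _
  have hr : 0 < R * ν := mul_pos hR hν0
  have hs : 0 < k * ν := mul_pos hk hν0
  have ha : 0 < R * ν / 8 := by positivity
  have ha1 : 2 * (R * ν / 8) ≤ 1 := by linarith
  have hpk : 0 ≤ 3 / (Real.pi * (k * ν) ^ 3) := by positivity
  -- the contributors: visible particles within `kν` of `x`
  set W : Finset (Fin (N + 1)) := Finset.univ.filter fun i => VisibleN ρs us R K N z i ∧ Torus.euclidDist x (z i).1 < k * ν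
    with hW
  -- (A) each contributor weighs at most the peak
  have hA : ∑ i, (if VisibleN ρs us R K N z i then cone k N x (z i).1 else 0) ≤ (W.card : ℝ) * (3 / (Real.pi * (k * ν) ^ 3)) := by
    calc ∑ i, (if VisibleN ρs us R K N z i then cone k N x (z i).1 else 0)
        ≤ ∑ i, (if i ∈ W then 3 / (Real.pi * (k * ν) ^ 3) else 0) := by
          refine Finset.sum_le_sum fun i _ => ?_
          by_cases hv : VisibleN ρs us R K N z i
          · rw [if_pos hv]
            by_cases hd : Torus.euclidDist x (z i).1 < k * ν
            · rw [if_pos (Finset.mem_filter.2 ⟨Finset.mem_univ _, hv, hd⟩)]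
              exact cone_le_peak' hs x _
            · rw [cone_eq_zero_of_le hs (not_lt.1 hd)]
              split_ifs <;> positivity
          · rw [if_neg hv]
            split_ifs <;> positivity
      _ = (W.card : ℝ) * (3 / (Real.pi * (k * ν) ^ 3)) := by
          rw [Finset.sum_ite_mem, Finset.univ_inter, Finset.sum_const, nsmul_eq_mul]
  -- a maximal `Rν/4`-separated visible subset covers the contributors
  obtain ⟨T, hTW, hsep, hcov⟩ := exists_separated_cover z ha W
  have hTvis : ∀ p ∈ T, VisibleN ρs us R K N z p ∧ Torus.euclidDist x (z p).1 < k * ν := fun p hp =>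
    (Finset.mem_filter.1 (hTW hp)).2
  -- (B) counting the contributors through the cover
  have hB : (W.card : ℝ) ≤ (T.card : ℝ) * (((N : ℝ) + 1) * (Real.pi * (R * ν) ^ 3) * ρmax) := by
    set f : Fin (N + 1) → Finset (Fin (N + 1)) := fun p => Finset.univ.filter fun j => dist (z p).1 (z j).1 ≤ R * ν / 4
      with hf
    have hsubU : W ⊆ T.biUnion f := by
      intro i hi
      obtain ⟨p, hp, hd⟩ := hcov i hi
      refine Finset.mem_biUnion.2 ⟨p, hp, Finset.mem_filter.2 ⟨Finset.mem_univ _, ?_⟩⟩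
      rw [dist_comm]; linarith
    calc (W.card : ℝ) ≤ ((T.biUnion f).card : ℝ) := by exact_mod_cast Finset.card_le_card hsubU
      _ ≤ ∑ p ∈ T, ((f p).card : ℝ) := by exact_mod_cast Finset.card_biUnion_le
      _ ≤ ∑ p ∈ T, ((N : ℝ) + 1) * (Real.pi * (R * ν) ^ 3) * ρmax := by
          refine Finset.sum_le_sum fun p hp => (card_near_visible_le hr (hTvis p hp).1).trans ?_
          exact mul_le_mul_of_nonneg_left (hρs _) (by positivity)
      _ = (T.card : ℝ) * (((N : ℝ) + 1) * (Real.pi * (R * ν) ^ 3) * ρmax) := by rw [Finset.sum_const, nsmul_eq_mul]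
  -- (C) packing bound on the cover
  have hC : (T.card : ℝ) ≤ ((k * ν + R * ν / 8) / (R * ν / 8)) ^ 3 :=
    card_le_of_separated z x ha ha1 hs.le T
      (fun p hp => (dist_le_euclidDist _ _).trans (hTvis p hp).2.le) hsep
  -- assembling
  have hBC : (W.card : ℝ) ≤ ((k * ν + R * ν / 8) / (R * ν / 8)) ^ 3 * (((N : ℝ) + 1) * (Real.pi * (R * ν) ^ 3) * ρmax) :=
    hB.trans (mul_le_mul_of_nonneg_right hC (by positivity))
  unfold visDensityN
  calc ((N : ℝ) + 1)⁻¹ * ∑ i, (if VisibleN ρs us R K N z i then cone k N x (z i).1 else 0)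
      ≤ ((N : ℝ) + 1)⁻¹ * ((W.card : ℝ) * (3 / (Real.pi * (k * ν) ^ 3))) := mul_le_mul_of_nonneg_left hA (by positivity)
    _ ≤ ((N : ℝ) + 1)⁻¹ * ((((k * ν + R * ν / 8) / (R * ν / 8)) ^ 3 * (((N : ℝ) + 1) * (Real.pi * (R * ν) ^ 3) * ρmax)) *
          (3 / (Real.pi * (k * ν) ^ 3))) :=
        mul_le_mul_of_nonneg_left (mul_le_mul_of_nonneg_right hBC hpk) (by positivity)
    _ = 3 * (8 + R / k) ^ 3 * ρmax := by
        field_simp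

end Covering

/-! ## The registered helper stub -/

/-- **Registered helper stub `stub_windowClauseCovering` (plan § 3 "covering lemma" of stub 4a-ii, skeleton v8, crux
stmt-17740)**: sorry-free conjunction of `visDensityN_le_geometric` (§ 4), the metric comparison `dist ≤ euclidDist ≤ 2 dist`
(§ 1, with the landed `ShearStressHalfDrudeFrozenGlueHelpers.dist_le_euclidDist`) and the volume of sup-balls of `𝕋³` (§ 1), restated
with fully qualified names (the registered one-line signature). -/
theorem stub_windowClauseCovering : (∀ (N : ℕ) (ρs : Literature.MathematicalPhysics.KineticTheory.T3 → ℝ) (us : Literature.MathematicalPhysics.KineticTheory.T3 → Literature.MathematicalPhysics.KineticTheory.V3) (R K k ρmax : ℝ), 0 < R → 0 < k → R * ((N : ℝ) + 1) ^ (-(1 / 3 : ℝ)) ≤ 4 → 0 ≤ ρmax → (∀ y, ρs y ≤ ρmax) → ∀ (z : Literature.Analysis.FluidPDE.Config (N + 1) (Fin 3) Literature.MathematicalPhysics.KineticTheory.T3) (x : Literature.MathematicalPhysics.KineticTheory.T3), Summit.AtomisticToContinuum.HydrodynamicLimit.Theorems.LTEInBand.visDensityN ρs us R K k N z x ≤ 3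 * (8 + R / k) ^ 3 * ρmax) ∧ (∀ (p q : Literature.MathematicalPhysics.KineticTheory.T3), dist p q ≤ Literature.Analysis.FluidPDE.Torus.euclidDist p q ∧ Literature.Analysis.FluidPDE.Torus.euclidDist p q ≤ 2 * dist p q) ∧ (∀ (p : Literature.MathematicalPhysics.KineticTheory.T3) (a : ℝ), 0 ≤ a → 2 * a ≤ 1 → MeasureTheory.volume (Metric.closedBall p a) = ENNReal.ofReal (2 * a) ^ 3) :=
  ⟨fun _ _ _ _ _ _ _ hR hk hRν hρmax hρs z x => visDensityN_le_geometric hR hk hRν hρmax hρs z x,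
    fun p q => ⟨dist_le_euclidDist p q, euclidDist_le_two_mul_dist p q⟩,
    fun p _ ha ha1 => volume_closedBall_T3 p ha ha1⟩

end Summit.AtomisticToContinuum.HydrodynamicLimit.Theorems.LTEInBand

end
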